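import Summits.ResolutionOfSingularities.ResolutionOfSingularities.Theorems.WeightedInvariantIota3DominanceWordResidue
import Summits.ResolutionOfSingularities.ResolutionOfSingularities.Theorems.WeightedInvariantKeyRungThreeOfDominance
import HarnessLib

/-!
# W4.3 door 19897 — the dominance word HOLDS at every position whose tangent form is not `c·ℓ^ν`, and the P3 rung `KeyRungGrHomLE 3 p` for the
# named pair `(ι₃ᵗ, J₃ᵗ)` modulo FIVE clause words + THE RESIDUE of the word (second-member dominance at `q < r₂ < r₁`)

Route `ResolutionOfSingularities/WeightedInvariant`, crux `Theses.WeightedInvariant.HypersurfaceCentreConstruction`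
(stmt-ResolutionOfSingularities-19897), door line `local-engine` (skeleton v3.12, `7a4b52ef4f5779aa`), registered stub
`stub_keyRungGrHomLE_three : ∀ p, p.Prime → KeyRungGrHomLE 3 p`.  Composition of `keyRungGrHomLE_three_of_dominance`
(…KeyRungThreeOfDominance: six hypotheses, one of them the dominance word `TwoFlagDominanceAtLevelLE3Body p`) with
`twoFlagDominanceAtLevelLE3Body_of_residue` (…Iota3DominanceWordResidue: the word ⟸ its residue, the ratio-one regime having been PROVED in
…Iota3RatioOneDominance{Prelims,,Flags}): `keyRungGrHomLE_three_of_residue`.  Its hypothesis list — (c8)≤3, (c10)≤3, (c11)≤3, (c9′-hom)≤3,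
the residue, (c8-gr)≤3 — IS the honest gap list of the registered stub after this hand.  Also: `Iota3.twoFlagDominanceAtLevelAt_of_not_power`
— the word `TwoFlagDominanceAtLevelAt f` holds OUTRIGHT at every `0 ≠ f ∈ 𝔪` (regular local, dimension `3`) with `f ∉ (ℓ^ν) + 𝔪^{ν+1}` for all
`ℓ ∈ 𝔪` (a reaching flag with `r₂ < r₁` would force `f ∈ (g₁^ν) + 𝔪^{ν+1}`), so the residue lives only at the positions `in_𝔪(f) = c·ℓ^ν`.
[OURS · L1 W4.3 · audit glue; candidates stay candidates; nothing here is a statement of H. Hironaka's 2017 manuscript; AI-written, weaker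
than expert review; no claim about resolution of singularities in characteristic `p` beyond the typed statements.]  No definition; no axiom.
-/

noncomputable section

set_option linter.dupNamespace false -- mandated namespace of this single-conjunct summit

open IsLocalRing Literature.AlgebraicGeometry.Resolution
open Summit.ResolutionOfSingularities.ResolutionOfSingularities.Theorems

namespace Summit.ResolutionOfSingularities.ResolutionOfSingularities.Cruxes.HypersurfaceCentreConstruction.LocalEngine

namespace Iota3

/-- A two-flag reaching a triple with `q ≤ r₂ < r₁` forces `f ∈ (g₁^ν) + 𝔪^{ν+1}` — the tangent form of `f` is a multiple of `ḡ₁^ν`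
(`flagContactFiltration_le_span_pow_sup_rest₂` + `rest₂_le_pow_succ`). [folklore] -/
theorem mem_span_pow_sup_of_reaches_of_lt {S : Type} [CommRing S] [IsLocalRing S] {f g₁ g₂ : S} (hg₁ : g₁ ∈ maximalIdeal S)
    (hg₂ : g₂ ∈ maximalIdeal S) {q r₁ r₂ ν : ℕ} (hq : 0 < q) (hq₂ : q ≤ r₂) (hr : r₂ < r₁)
    (hF : f ∈ flagContactFiltration g₁ g₂ q r₁ r₂ (r₁ * ν)) :
    f ∈ Ideal.span {g₁ ^ ν} ⊔ maximalIdeal S ^ (ν + 1) := by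
  obtain ⟨t, ht, m, hm, htm⟩ := Submodule.mem_sup.mp (flagContactFiltration_le_span_pow_sup_rest₂ g₁ g₂ q r₁ r₂ ν hF)
  rw [← htm]
  exact Ideal.add_mem _ (Ideal.mem_sup_left ht) (Ideal.mem_sup_right (rest₂_le_pow_succ hg₁ hg₂ hq hq₂ hr ν hm))

/-- **THE DOMINANCE WORD HOLDS OUTRIGHT AT EVERY POSITION WHOSE TANGENT FORM IS NOT A `ν`-TH POWER OF A LINEAR FORM** (`S` regular local
of dimension `3`, `0 ≠ f ∈ 𝔪`, `f ∉ (ℓ^ν) + 𝔪^{ν+1}` for all `ℓ ∈ 𝔪`, `ν = ord f`): every instance of `TwoFlagDominanceAtLevelAt f` then has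
`r₁ = r₂` (a reaching flag with `r₂ < r₁` would give `f ∈ (g₁^ν) + 𝔪^{ν+1}`), and the ratio-one regime is `dominanceAtLevel_of_r₁_eq_r₂`.
So the residue of the word lives only at the positions with `in_𝔪(f) = c·ℓ^ν`. [OURS · L1 W4.3 · (o70-b)/(Δ12)] -/
theorem twoFlagDominanceAtLevelAt_of_not_power {S : Type} [CommRing S] [IsRegularLocalRing S] (hdim : ringKrullDim S = (3 : ℕ))
    {f : S} (hf0 : f ≠ 0) (hfm : f ∈ maximalIdeal S)
    (hNP : ∀ ℓ ∈ maximalIdeal S, f ∉ Ideal.span {ℓ ^ (adicOrder f).toNat} ⊔ maximalIdeal S ^ ((adicOrder f).toNat + 1)) :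
    TwoFlagDominanceAtLevelAt f := by
  intro a b hb hbound g₁ g₂ g₁' g₂' q r₁ r₂ hadm hab hΦ hΦ' hF hF'
  rcases (hadm.2.2 : r₂ ≤ r₁).eq_or_lt with hrr | hlt
  · exact dominanceAtLevel_of_r₁_eq_r₂ hdim hf0 hfm hb hbound hadm hab hrr.symm hΦ hΦ' hF hF'
  · exact absurd (mem_span_pow_sup_of_reaches_of_lt hΦ.1 hΦ.2.1 hadm.1 hadm.2.1 hlt hF) (hNP g₁ hΦ.1)

end Iota3

/-- **P3 RUNG FOR THE NAMED PAIR MODULO FIVE CLAUSE WORDS AND THE RESIDUE OF THE DOMINANCE WORD**: `KeyRungGrHomLE 3 p` for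
`(iotaFlatT, jFlatT)` from (c8)≤3, (c10)≤3, (c11)≤3, (c9′-hom)≤3, (c8-gr)≤3 and the SECOND-MEMBER dominance at the triples `q < r₂ < r₁`
(`twoFlagDominanceAtLevelLE3Body_of_residue` ∘ `keyRungGrHomLE_three_of_dominance`).  The hypothesis list is the gap list of the registered
stub `stub_keyRungGrHomLE_three` after this hand. [OURS · audit glue] -/
theorem keyRungGrHomLE_three_of_residue (p : ℕ)
    (hc8 : IotaUpperSemicontinuousLE 3 p Iota3.iotaFlatT)
    (hc10 : IotaTorusFactorMonotoneLE 3 p Iota3.iotaFlatT)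
    (hc11 : IotaJEssSmoothCompatibleLE 3 Iota3.iotaFlatT Iota3.jFlatT)
    (hgame : CanonicalGameClauseHomLE 3 p Iota3.iotaFlatT Iota3.jFlatT)
    (hres : ∀ (k₀ : Type) [Field k₀] [CharP k₀ p] [PerfectField k₀]
      (S : Type) [CommRing S] [Algebra k₀ S] [Algebra.EssFiniteType k₀ S] [IsRegularLocalRing S] (f : S),
      ringKrullDim S = (3 : ℕ) → f ≠ 0 → f ∈ (maximalIdeal S) ^ 2 →
      ContactCylinder.topStratumPrime Iota3.iotaOrdEpsTau S f = maximalIdeal S → Iota3.iotaEps S f ≠ 1 →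
      ∀ (a b : ℕ), 0 < b →
      (∀ q' r₁' r₂' : ℕ, Iota3.AdmissibleTriple q' r₁' r₂' → Iota3.FlagReaches f (adicOrder f).toNat q' r₁' r₂' →
        r₁' * b ≤ a * r₂') →
      ∀ (g₁ g₂ g₁' g₂' : S) (q r₁ r₂ : ℕ), Iota3.AdmissibleTriple q r₁ r₂ → r₁ * b = a * r₂ → q < r₂ → r₂ < r₁ →
        Iota3.IsTwoFlag g₁ g₂ → Iota3.IsTwoFlag g₁' g₂' →
        f ∈ Iota3.flagContactFiltration g₁ g₂ q r₁ r₂ (r₁ * (adicOrder f).toNat) →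
        f ∈ Iota3.flagContactFiltration g₁' g₂' q r₁ r₂ (r₁ * (adicOrder f).toNat) →
        g₂' ∈ Iota3.flagContactFiltration g₁ g₂ q r₁ r₂ r₂)
    (hgr : IotaUpperSemicontinuousGradedLE 3 p Iota3.iotaFlatT) :
    KeyRungGrHomLE 3 p :=
  keyRungGrHomLE_three_of_dominance p hc8 hc10 hc11 hgame (twoFlagDominanceAtLevelLE3Body_of_residue p hres) hgr

end Summit.ResolutionOfSingularities.ResolutionOfSingularities.Cruxes.HypersurfaceCentreConstruction.LocalEngine

end
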